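import Summits.Ventures.WeilGRH.TwistedComplexColumns
import Summits.RiemannHypothesis.RiemannHypothesis.Theorems.WeilFormatCTailJPrelim
import Summits.RiemannHypothesis.RiemannHypothesis.Theorems.WeilFormatCTailMajorant
import Summits.RiemannHypothesis.RiemannHypothesis.Theorems.WeilFormatCSoundness
import HarnessLib

/-!
# GRH arm (rh-explicit, venture WeilGRH): twisted format C for a COMPLEX character — the order-`J` TAIL majorant on the
  two-sided enumeration of the far modes (L-C3b on `ℤ`, Hankel form)

Cell `rh-explicit`, WEIL TRACK — GRH ARM (lit/typing seat weil-grh-5 gen11).  Sequel of `TwistedComplexColumns.lean`.  For the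
real kernel `G = Re twistedGramCoeffC χ a` on `ℤ` (Cauchy structure `G(p,m) = (−1)^{p+m}(F^χ_m − F^χ_p)/(π(m−p))`), block rows
`p = ι(i)`, `i < 2B − 1` (`ι(i) = 0, 1, −1, 2, −2, …`, `|ι i| ≤ B − 1`) and far modes `|m| ≥ B₃ ≥ 2B`:

* `cauchy_tailJ_majorant` — the ABSTRACT one-sided order-`J` tail bound (weil-10's `even_tailJ_majorant` argument for any
  column family `col m i = (−1)^m[(F_m/π)Σ_j v^A_j(i)/m^{j+1} + Σ_j v^B_j(i)/m^{j+1}] + O(ρ_i/m^{J+1})`, `|F_m| ≤ C_A`):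
  Peter–Paul twice, weights `1/d_m ≤ 1/d₀`, and weil-10's Hankel bounds `sum_Ico_sq_sum_div_pow_le` (exponents `j+1`),
  `sum_Ico_one_div_pow_two_mul_le`;
* `complex_tailJ_majorant_pos` / `complex_tailJ_majorant_neg` — its two instances `m ↦ G(ι i, m)` and `m ↦ G(ι i, −m)`
  (`m ≥ B₃`): families `v^A_j(i) = (−1)^{ι i}(ι i)^j`, `v^B_j(i) = (−1)^{ι i}(−(ι i)^j F^χ_{ι i}/π)` for `+m`, and the same times
  `(−1)^{j+1}` for `−m`; `ρ_i = 4C_F|ι i|^J/π`; mode functions `F^χ_{±m}`, `|F^χ_{±m}| ≤ C_A = π/4 + ΛΣ + a(1+E)/(πB₃)`;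
No definitions; no named facts; RH/GRH-free; standard axioms.  The two-sided pairing on the enumeration `κ`, the explicit
matrix `U₂` and the data door are the sequel (`TwistedComplexDataRungJ.lean`).
-/

set_option autoImplicit false

noncomputable section

open Complex Finset Matrix
open scoped Real BigOperators ComplexConjugate ArithmeticFunction.vonMangoldt

namespace Summit.Ventures.WeilGRH

open Literature.NumberTheory.LFunctions
open Literature.NumberTheory.LFunctions.Yoshida1992 (freq archExpSumSin)
open Literature.Analysis.SpecialFunctions
open Summit.RiemannHypothesis.RiemannHypothesis.Theorems.WeilFormatC

variable {q : ℕ} {a : ℝ}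

/-! ## The abstract one-sided Cauchy tail at order `J` -/

section Abstract

/-- **Abstract order-`J` tail majorant** (weil-10's `even_tailJ_majorant` argument, for any column family with a two-family
polynomial structure in `1/m` and an `O(m^{−(J+1)})` remainder). -/
theorem cauchy_tailJ_majorant {Bb J B₃ : ℕ} (hB₃ : 2 ≤ B₃) (col : ℕ → Fin Bb → ℝ) (Fm : ℕ → ℝ) {CA : ℝ}
    (vA vB : Fin J → Fin Bb → ℝ) (ρ : Fin Bb → ℝ) (lam : Fin J → ℝ) (hlam : ∀ j, 0 < lam j)
    (hF : ∀ m, B₃ ≤ m → |Fm m| ≤ CA)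
    (hcol : ∀ m, B₃ ≤ m → ∀ i,
      |col m i - (-1 : ℝ) ^ m * (Fm m / π * ∑ j : Fin J, vA j i / (m : ℝ) ^ ((j : ℕ) + 1)
        + ∑ j : Fin J, vB j i / (m : ℝ) ^ ((j : ℕ) + 1))| ≤ ρ i / (m : ℝ) ^ (J + 1))
    (d : ℕ → ℝ) {d₀ : ℝ} (hd₀ : 0 < d₀) (hd : ∀ m, B₃ ≤ m → d₀ ≤ d m) {θ η : ℝ} (hθ : 0 < θ) (hη : 0 < η)
    (N : ℕ) (x : Fin Bb → ℝ) :
    ∑ m ∈ Finset.Ico B₃ N, (∑ i, col m i * x i) ^ 2 / d m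
      ≤ (1 + θ) * (1 + η) * (CA ^ 2 / (π ^ 2 * d₀))
          * ((∑ j : Fin J, ∑ j' : Fin J, (∑ i, vA j i * x i) * (∑ i, vA j' i * x i)
                * ((1 / ((((j : ℕ) + 1) + ((j' : ℕ) + 1) - 1 : ℕ) * (((B₃ - 1 : ℕ) : ℝ)) ^ (((j : ℕ) + 1) + ((j' : ℕ) + 1) - 1))
                    + 1 / ((((j : ℕ) + 1) + ((j' : ℕ) + 1) - 1 : ℕ) * (B₃ : ℝ) ^ (((j : ℕ) + 1) + ((j' : ℕ) + 1) - 1))) / 2))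
              + ∑ j : Fin J, (∑ i, vA j i * x i) ^ 2 * ∑ j' : Fin J,
                  ((1 / ((((j : ℕ) + 1) + ((j' : ℕ) + 1) - 1 : ℕ) * (((B₃ - 1 : ℕ) : ℝ)) ^ (((j : ℕ) + 1) + ((j' : ℕ) + 1) - 1))
                    - 1 / ((((j : ℕ) + 1) + ((j' : ℕ) + 1) - 1 : ℕ) * (B₃ : ℝ) ^ (((j : ℕ) + 1) + ((j' : ℕ) + 1) - 1))) / 2)
                  * lam j' / lam j)
        + (1 + θ) * (1 + η⁻¹) * (1 / d₀)
          * ((∑ j : Fin J, ∑ j' : Fin J, (∑ i, vB j i * x i) * (∑ i, vB j' i * x i)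
                * ((1 / ((((j : ℕ) + 1) + ((j' : ℕ) + 1) - 1 : ℕ) * (((B₃ - 1 : ℕ) : ℝ)) ^ (((j : ℕ) + 1) + ((j' : ℕ) + 1) - 1))
                    + 1 / ((((j : ℕ) + 1) + ((j' : ℕ) + 1) - 1 : ℕ) * (B₃ : ℝ) ^ (((j : ℕ) + 1) + ((j' : ℕ) + 1) - 1))) / 2))
              + ∑ j : Fin J, (∑ i, vB j i * x i) ^ 2 * ∑ j' : Fin J,
                  ((1 / ((((j : ℕ) + 1) + ((j' : ℕ) + 1) - 1 : ℕ) * (((B₃ - 1 : ℕ) : ℝ)) ^ (((j : ℕ) + 1) + ((j' : ℕ) + 1) - 1))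
                    - 1 / ((((j : ℕ) + 1) + ((j' : ℕ) + 1) - 1 : ℕ) * (B₃ : ℝ) ^ (((j : ℕ) + 1) + ((j' : ℕ) + 1) - 1))) / 2)
                  * lam j' / lam j)
        + (1 + θ⁻¹) * ((Bb : ℝ) / (d₀ * ((2 * J + 1 : ℕ) * (((B₃ - 1 : ℕ) : ℝ)) ^ (2 * J + 1))))
          * ∑ i, ρ i ^ 2 * x i ^ 2 := by
  set T := Finset.Ico B₃ N with hT
  have hB₃1 : 1 ≤ B₃ := by omega
  set αA : Fin J → ℝ := fun j ↦ ∑ i, vA j i * x i with hαA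
  set αB : Fin J → ℝ := fun j ↦ ∑ i, vB j i * x i with hαB
  have hCA : ∀ m ∈ T, 0 ≤ CA := fun m hm ↦ (abs_nonneg _).trans (hF m (Finset.mem_Ico.mp hm).1)
  -- per-mode estimate
  have key : ∀ m ∈ T, (∑ i, col m i * x i) ^ 2 / d m
      ≤ (1 + θ) * (1 + η) * (CA ^ 2 / (π ^ 2 * d₀)) * (∑ j, αA j / (m : ℝ) ^ ((j : ℕ) + 1)) ^ 2
        + (1 + θ) * (1 + η⁻¹) * (1 / d₀) * (∑ j, αB j / (m : ℝ) ^ ((j : ℕ) + 1)) ^ 2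
        + (1 + θ⁻¹) * ((Bb : ℝ) / d₀) * (∑ i, ρ i ^ 2 * x i ^ 2) * (1 / ((m : ℝ) ^ (J + 1)) ^ 2) := by
    intro m hm
    have hmB := (Finset.mem_Ico.mp hm).1
    have hm1 : 1 ≤ m := le_trans hB₃1 hmB
    have hm0 : (0 : ℝ) < m := by exact_mod_cast hm1
    have hdm : d₀ ≤ d m := hd m hmB
    have hdpos : 0 < d m := lt_of_lt_of_le hd₀ hdm
    set R : ℝ := ∑ i, (col m i - (-1 : ℝ) ^ m * (Fm m / π * ∑ j : Fin J, vA j i / (m : ℝ) ^ ((j : ℕ) + 1)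
        + ∑ j : Fin J, vB j i / (m : ℝ) ^ ((j : ℕ) + 1))) * x i with hR
    have hsplit : ∑ i, col m i * x i
        = (-1 : ℝ) ^ m * (Fm m / π * (∑ j, αA j / (m : ℝ) ^ ((j : ℕ) + 1)) + (∑ j, αB j / (m : ℝ) ^ ((j : ℕ) + 1))) + R := by
      have ePA : (∑ j, αA j / (m : ℝ) ^ ((j : ℕ) + 1)) = ∑ i, (∑ j : Fin J, vA j i / (m : ℝ) ^ ((j : ℕ) + 1)) * x i := by
        simp only [hαA, Finset.sum_div]
        rw [Finset.sum_comm]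
        refine Finset.sum_congr rfl fun i _ ↦ ?_
        rw [Finset.sum_mul]
        refine Finset.sum_congr rfl fun j _ ↦ by ring
      have ePB : (∑ j, αB j / (m : ℝ) ^ ((j : ℕ) + 1)) = ∑ i, (∑ j : Fin J, vB j i / (m : ℝ) ^ ((j : ℕ) + 1)) * x i := by
        simp only [hαB, Finset.sum_div]
        rw [Finset.sum_comm]
        refine Finset.sum_congr rfl fun i _ ↦ ?_
        rw [Finset.sum_mul]
        refine Finset.sum_congr rfl fun j _ ↦ by ring
      rw [ePA, ePB, hR, Finset.mul_sum, mul_add, Finset.mul_sum, Finset.mul_sum, ← Finset.sum_add_distrib,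
        ← Finset.sum_add_distrib]
      refine Finset.sum_congr rfl fun i _ ↦ by ring
    have hRsq : R ^ 2 ≤ (Bb : ℝ) * (∑ i, ρ i ^ 2 * x i ^ 2) * (1 / ((m : ℝ) ^ (J + 1)) ^ 2) := by
      have h := sq_sum_mul_le_card_mul (ι := Fin Bb) _ (fun i ↦ ρ i / (m : ℝ) ^ (J + 1)) x (hcol m hmB)
      simp only [Fintype.card_fin] at h
      refine h.trans (le_of_eq ?_)
      rw [mul_assoc, Finset.sum_mul]
      congr 1
      refine Finset.sum_congr rfl fun i _ ↦ ?_
      rw [div_pow]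
      ring
    have hFm : |Fm m| ≤ CA := hF m hmB
    have hmain : (Fm m / π * (∑ j, αA j / (m : ℝ) ^ ((j : ℕ) + 1)) + (∑ j, αB j / (m : ℝ) ^ ((j : ℕ) + 1))) ^ 2
        ≤ (1 + η) * (CA ^ 2 / π ^ 2) * (∑ j, αA j / (m : ℝ) ^ ((j : ℕ) + 1)) ^ 2
          + (1 + η⁻¹) * (∑ j, αB j / (m : ℝ) ^ ((j : ℕ) + 1)) ^ 2 := by
      have hpp := sq_add_le_peterPaul (p := Fm m / π * (∑ j, αA j / (m : ℝ) ^ ((j : ℕ) + 1)))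
        (q := (∑ j, αB j / (m : ℝ) ^ ((j : ℕ) + 1))) hη
      have hF2 : (Fm m / π * (∑ j, αA j / (m : ℝ) ^ ((j : ℕ) + 1))) ^ 2
          ≤ CA ^ 2 / π ^ 2 * (∑ j, αA j / (m : ℝ) ^ ((j : ℕ) + 1)) ^ 2 := by
        rw [mul_pow, div_pow]
        refine mul_le_mul_of_nonneg_right ?_ (sq_nonneg _)
        refine div_le_div_of_nonneg_right ?_ (by positivity)
        calc Fm m ^ 2 = |Fm m| ^ 2 := (sq_abs _).symm
          _ ≤ CA ^ 2 := pow_le_pow_left₀ (abs_nonneg _) hFm 2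
      have h1 : 0 ≤ 1 + η := by positivity
      refine hpp.trans ((add_le_add (mul_le_mul_of_nonneg_left hF2 h1) le_rfl).trans (le_of_eq ?_))
      ring
    have hsq : (∑ i, col m i * x i) ^ 2
        ≤ (1 + θ) * ((1 + η) * (CA ^ 2 / π ^ 2) * (∑ j, αA j / (m : ℝ) ^ ((j : ℕ) + 1)) ^ 2
            + (1 + η⁻¹) * (∑ j, αB j / (m : ℝ) ^ ((j : ℕ) + 1)) ^ 2)
          + (1 + θ⁻¹) * ((Bb : ℝ) * (∑ i, ρ i ^ 2 * x i ^ 2) * (1 / ((m : ℝ) ^ (J + 1)) ^ 2)) := by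
      rw [hsplit]
      have hpp := sq_add_le_peterPaul (p := (-1 : ℝ) ^ m * (Fm m / π * (∑ j, αA j / (m : ℝ) ^ ((j : ℕ) + 1))
        + (∑ j, αB j / (m : ℝ) ^ ((j : ℕ) + 1)))) (q := R) hθ
      have hsgn : ((-1 : ℝ) ^ m * (Fm m / π * (∑ j, αA j / (m : ℝ) ^ ((j : ℕ) + 1))
          + (∑ j, αB j / (m : ℝ) ^ ((j : ℕ) + 1)))) ^ 2
          = (Fm m / π * (∑ j, αA j / (m : ℝ) ^ ((j : ℕ) + 1)) + (∑ j, αB j / (m : ℝ) ^ ((j : ℕ) + 1))) ^ 2 := by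
        rw [mul_pow, ← pow_mul, Even.neg_one_pow (by exact ⟨m, by ring⟩), one_mul]
      rw [hsgn] at hpp
      have h1 : 0 ≤ 1 + θ := by positivity
      have h2 : 0 ≤ 1 + θ⁻¹ := by positivity
      exact hpp.trans (add_le_add (mul_le_mul_of_nonneg_left hmain h1) (mul_le_mul_of_nonneg_left hRsq h2))
    have hnn : 0 ≤ (1 + θ) * ((1 + η) * (CA ^ 2 / π ^ 2) * (∑ j, αA j / (m : ℝ) ^ ((j : ℕ) + 1)) ^ 2
            + (1 + η⁻¹) * (∑ j, αB j / (m : ℝ) ^ ((j : ℕ) + 1)) ^ 2)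
          + (1 + θ⁻¹) * ((Bb : ℝ) * (∑ i, ρ i ^ 2 * x i ^ 2) * (1 / ((m : ℝ) ^ (J + 1)) ^ 2)) := by
      have : 0 ≤ ∑ i, ρ i ^ 2 * x i ^ 2 := Finset.sum_nonneg fun i _ ↦ by positivity
      have : 0 ≤ CA := hCA m hm
      positivity
    calc (∑ i, col m i * x i) ^ 2 / d m
        ≤ _ := div_le_div_of_nonneg_right hsq hdpos.le
      _ ≤ ((1 + θ) * ((1 + η) * (CA ^ 2 / π ^ 2) * (∑ j, αA j / (m : ℝ) ^ ((j : ℕ) + 1)) ^ 2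
            + (1 + η⁻¹) * (∑ j, αB j / (m : ℝ) ^ ((j : ℕ) + 1)) ^ 2)
          + (1 + θ⁻¹) * ((Bb : ℝ) * (∑ i, ρ i ^ 2 * x i ^ 2) * (1 / ((m : ℝ) ^ (J + 1)) ^ 2))) / d₀ :=
          div_le_div_of_nonneg_left hnn hd₀ hdm
      _ = _ := by
          field_simp
  -- sum over the tail and apply the Hankel bounds
  have hsumA := sum_Ico_sq_sum_div_pow_le (D := J) (fun j ↦ (j : ℕ) + 1) (fun j ↦ by omega) hB₃ lam hlam N αA
  have hsumB := sum_Ico_sq_sum_div_pow_le (D := J) (fun j ↦ (j : ℕ) + 1) (fun j ↦ by omega) hB₃ lam hlam N αB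
  have hsumR := sum_Ico_one_div_pow_two_mul_le (E := J + 1) (by omega) hB₃ N
  have h2J : 2 * (J + 1) - 1 = 2 * J + 1 := by omega
  rw [h2J] at hsumR
  have hCA0 : 0 ≤ CA ^ 2 / (π ^ 2 * d₀) := by positivity
  have hcA : 0 ≤ (1 + θ) * (1 + η) * (CA ^ 2 / (π ^ 2 * d₀)) := by positivity
  have hcB : 0 ≤ (1 + θ) * (1 + η⁻¹) * (1 / d₀) := by positivity
  have hcR : 0 ≤ (1 + θ⁻¹) * ((Bb : ℝ) / d₀) * (∑ i, ρ i ^ 2 * x i ^ 2) := by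
    have : 0 ≤ ∑ i, ρ i ^ 2 * x i ^ 2 := Finset.sum_nonneg fun i _ ↦ by positivity
    positivity
  have hR' : ∑ m ∈ T, 1 / ((m : ℝ) ^ (J + 1)) ^ 2 ≤ 1 / ((2 * J + 1 : ℕ) * (((B₃ - 1 : ℕ) : ℝ)) ^ (2 * J + 1)) := hsumR
  have step1 : ∑ m ∈ T, (∑ i, col m i * x i) ^ 2 / d m
      ≤ (1 + θ) * (1 + η) * (CA ^ 2 / (π ^ 2 * d₀)) * ∑ m ∈ T, (∑ j, αA j / (m : ℝ) ^ ((j : ℕ) + 1)) ^ 2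
          + (1 + θ) * (1 + η⁻¹) * (1 / d₀) * ∑ m ∈ T, (∑ j, αB j / (m : ℝ) ^ ((j : ℕ) + 1)) ^ 2
          + (1 + θ⁻¹) * ((Bb : ℝ) / d₀) * (∑ i, ρ i ^ 2 * x i ^ 2) * ∑ m ∈ T, (1 / ((m : ℝ) ^ (J + 1)) ^ 2) := by
    refine (Finset.sum_le_sum key).trans (le_of_eq ?_)
    simp only [Finset.sum_add_distrib, ← Finset.mul_sum]
  have step2 := add_le_add (add_le_add (mul_le_mul_of_nonneg_left hsumA hcA) (mul_le_mul_of_nonneg_left hsumB hcB))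
    (mul_le_mul_of_nonneg_left hR' hcR)
  refine (step1.trans step2).trans (le_of_eq ?_)
  simp only [hαA, hαB]
  ring

end Abstract

/-! ## The two instances: columns `m ↦ G(ι i, m)` and `m ↦ G(ι i, −m)` -/

section Instances

/-- The block modes `ι(i) = 0, 1, −1, 2, −2, …` have `|ι i| ≤ B − 1` for `i < 2B − 1`. -/
theorem natAbs_iota_le {B : ℕ} (i : Fin (2 * B - 1)) :
    (if (i : ℕ) % 2 = 1 then ((((i : ℕ) + 1) / 2 : ℕ) : ℤ) else -((((i : ℕ) / 2 : ℕ) : ℤ))).natAbs ≤ B - 1 := by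
  have hi := i.isLt
  split_ifs <;> simp only [Int.natAbs_neg, Int.natAbs_natCast] <;> omega

/-- `v/(−m)^n = ((−1)^n v)/m^n`. -/
private theorem div_neg_pow_eq (v m : ℝ) (n : ℕ) : v / (-m) ^ n = ((-1 : ℝ) ^ n * v) / m ^ n := by
  rcases Nat.even_or_odd n with h | h
  · rw [h.neg_pow, h.neg_one_pow, one_mul]
  · rw [h.neg_pow, h.neg_one_pow, neg_one_mul, neg_div, div_neg]

/-- `(−1)^{−m} = (−1)^m` for `m : ℕ` (as an integer power). -/
private theorem neg_one_zpow_neg_natCast (m : ℕ) : (-1 : ℝ) ^ (-(m : ℤ)) = (-1 : ℝ) ^ m := by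
  rw [_root_.zpow_neg, zpow_natCast, ← inv_pow, inv_neg_one]

/-- **Order-`J` tail majorant, far modes `m ≥ B₃` (positive side).**  Rows `p = ι(i)`, `i < 2B − 1`; `2B ≤ B₃`. -/
theorem complex_tailJ_majorant_pos (χ : DirichletCharacter ℂ q) (ha : 0 < a) {B B₃ : ℕ} (hB : 1 ≤ B)
    (hBB : 2 * B ≤ B₃) (J : ℕ) (lam : Fin J → ℝ) (hlam : ∀ j, 0 < lam j)
    (d : ℕ → ℝ) {d₀ : ℝ} (hd₀ : 0 < d₀) (hd : ∀ m, B₃ ≤ m → d₀ ≤ d m) {θ η : ℝ} (hθ : 0 < θ) (hη : 0 < η)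
    (N : ℕ) (x : Fin (2 * B - 1) → ℝ) :
    ∑ m ∈ Finset.Ico B₃ N, (∑ i : Fin (2 * B - 1),
        (twistedGramCoeffC χ a (if (i : ℕ) % 2 = 1 then ((((i : ℕ) + 1) / 2 : ℕ) : ℤ) else -((((i : ℕ) / 2 : ℕ) : ℤ))) (m : ℤ)).re * x i) ^ 2 / d m
      ≤ (1 + θ) * (1 + η) * ((π / 4 + (∑ k ∈ weilPrimeIndex a, (Λ k : ℝ) / Real.sqrt k) + a * (1 + weilArchDensity (2 * a)) / (π * B₃)) ^ 2 / (π ^ 2 * d₀))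
          * ((∑ j : Fin J, ∑ j' : Fin J, (∑ i : Fin (2 * B - 1), ((-1 : ℝ) ^ (if (i : ℕ) % 2 = 1 then ((((i : ℕ) + 1) / 2 : ℕ) : ℤ) else -((((i : ℕ) / 2 : ℕ) : ℤ))) * (((if (i : ℕ) % 2 = 1 then ((((i : ℕ) + 1) / 2 : ℕ) : ℤ) else -((((i : ℕ) / 2 : ℕ) : ℤ))) : ℤ) : ℝ) ^ (j : ℕ)) * x i) * (∑ i : Fin (2 * B - 1), ((-1 : ℝ) ^ (if (i : ℕ) % 2 = 1 then ((((i : ℕ) + 1) / 2 : ℕ) : ℤ) else -((((i : ℕ) / 2 : ℕ) : ℤ))) * (((if (i : ℕ) % 2 = 1 then ((((i : ℕ) + 1) / 2 : ℕ) : ℤ) else -((((i : ℕ) / 2 : ℕ) : ℤ))) : ℤ) : ℝ) ^ (j' : ℕ)) * x i)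
                * ((1 / ((((j : ℕ) + 1) + ((j' : ℕ) + 1) - 1 : ℕ) * (((B₃ - 1 : ℕ) : ℝ)) ^ (((j : ℕ) + 1) + ((j' : ℕ) + 1) - 1))
                    + 1 / ((((j : ℕ) + 1) + ((j' : ℕ) + 1) - 1 : ℕ) * (B₃ : ℝ) ^ (((j : ℕ) + 1) + ((j' : ℕ) + 1) - 1))) / 2))
              + ∑ j : Fin J, (∑ i : Fin (2 * B - 1), ((-1 : ℝ) ^ (if (i : ℕ) % 2 = 1 then ((((i : ℕ) + 1) / 2 : ℕ) : ℤ) else -((((i : ℕ) / 2 : ℕ) : ℤ))) * (((if (i : ℕ) % 2 = 1 then ((((i : ℕ) + 1) / 2 : ℕ) : ℤ) else -((((i : ℕ) / 2 : ℕ) : ℤ))) : ℤ) : ℝ) ^ (j : ℕ)) * x i) ^ 2 * ∑ j' : Fin J,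
                  ((1 / ((((j : ℕ) + 1) + ((j' : ℕ) + 1) - 1 : ℕ) * (((B₃ - 1 : ℕ) : ℝ)) ^ (((j : ℕ) + 1) + ((j' : ℕ) + 1) - 1))
                    - 1 / ((((j : ℕ) + 1) + ((j' : ℕ) + 1) - 1 : ℕ) * (B₃ : ℝ) ^ (((j : ℕ) + 1) + ((j' : ℕ) + 1) - 1))) / 2)
                  * lam j' / lam j)
        + (1 + θ) * (1 + η⁻¹) * (1 / d₀)
          * ((∑ j : Fin J, ∑ j' : Fin J, (∑ i : Fin (2 * B - 1), ((-1 : ℝ) ^ (if (i : ℕ) % 2 = 1 then ((((i : ℕ) + 1) / 2 : ℕ) : ℤ) else -((((i : ℕ) / 2 : ℕ) : ℤ))) * (-((((if (i : ℕ) % 2 = 1 then ((((i : ℕ) + 1) / 2 : ℕ) : ℤ) else -((((i : ℕ) / 2 : ℕ) : ℤ))) : ℤ) : ℝ) ^ (j : ℕ)) * ((Complex.digamma (1 / 4 + ((freq a (if (i : ℕ) % 2 = 1 then ((((i : ℕ) + 1) / 2 : ℕ) : ℤ) else -((((i : ℕ) / 2 : ℕ) : ℤ))) : ℝ) : ℂ)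 / 2 * I)).im / 2 + (∑ k ∈ weilPrimeIndex a, (Λ k : ℝ) / Real.sqrt k * ((χ (k : ZMod q)).re * Real.sin (freq a (if (i : ℕ) % 2 = 1 then ((((i : ℕ) + 1) / 2 : ℕ) : ℤ) else -((((i : ℕ) / 2 : ℕ) : ℤ))) * Real.log k) + (χ (k : ZMod q)).im * Real.cos (freq a (if (i : ℕ) % 2 = 1 then ((((i : ℕ) + 1) / 2 : ℕ) : ℤ) else -((((i : ℕ) / 2 : ℕ) : ℤ))) * Real.log k))) - archExpSumSin a (if (i : ℕ) % 2 = 1 then ((((i : ℕ) + 1) / 2 : ℕ) : ℤ) else -((((i : ℕ) / 2 : ℕ) : ℤ)))) / π)) * x i) * (∑ i : Fin (2 * B - 1), ((-1 : ℝ) ^ (if (i : ℕ) % 2 = 1 then ((((i : ℕ) + 1) / 2 : ℕ) : ℤ) else -((((i : ℕ) / 2 : ℕ) : ℤ))) * (-((((if (i : ℕ) % 2 = 1 then ((((i : ℕ) + 1) / 2 : ℕ) : ℤ) else -((((i : ℕ) / 2 : ℕ) : ℤ))) : ℤ) : ℝ) ^ (j' : ℕ)) * ((Complex.digamma (1 /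 4 + ((freq a (if (i : ℕ) % 2 = 1 then ((((i : ℕ) + 1) / 2 : ℕ) : ℤ) else -((((i : ℕ) / 2 : ℕ) : ℤ))) : ℝ) : ℂ) / 2 * I)).im / 2 + (∑ k ∈ weilPrimeIndex a, (Λ k : ℝ) / Real.sqrt k * ((χ (k : ZMod q)).re * Real.sin (freq a (if (i : ℕ) % 2 = 1 then ((((i : ℕ) + 1) / 2 : ℕ) : ℤ) else -((((i : ℕ) / 2 : ℕ) : ℤ))) * Real.log k) + (χ (k : ZMod q)).im * Real.cos (freq a (if (i : ℕ) % 2 = 1 then ((((i : ℕ) + 1) / 2 : ℕ) : ℤ) else -((((i : ℕ) / 2 : ℕ) : ℤ))) * Real.log k))) - archExpSumSin a (if (i : ℕ) % 2 = 1 then ((((i : ℕ) + 1) / 2 : ℕ) : ℤ) else -((((i : ℕ) / 2 : ℕ) : ℤ)))) / π)) * x i)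
                * ((1 / ((((j : ℕ) + 1) + ((j' : ℕ) + 1) - 1 : ℕ) * (((B₃ - 1 : ℕ) : ℝ)) ^ (((j : ℕ) + 1) + ((j' : ℕ) + 1) - 1))
                    + 1 / ((((j : ℕ) + 1) + ((j' : ℕ) + 1) - 1 : ℕ) * (B₃ : ℝ) ^ (((j : ℕ) + 1) + ((j' : ℕ) + 1) - 1))) / 2))
              + ∑ j : Fin J, (∑ i : Fin (2 * B - 1), ((-1 : ℝ) ^ (if (i : ℕ) % 2 = 1 then ((((i : ℕ) + 1) / 2 : ℕ) : ℤ) else -((((i : ℕ) / 2 : ℕ) : ℤ))) * (-((((if (i : ℕ) % 2 = 1 then ((((i : ℕ) + 1) / 2 : ℕ) : ℤ) else -((((i : ℕ) / 2 : ℕ) : ℤ))) : ℤ) : ℝ) ^ (j : ℕ)) * ((Complex.digamma (1 / 4 + ((freq a (if (i : ℕ) % 2 = 1 then ((((i : ℕ) + 1) / 2 : ℕ) : ℤ) else -((((i : ℕ) / 2 : ℕ) : ℤ))) : ℝ) : ℂ) / 2 * I)).im / 2 + (∑ k ∈ weilPrimeIndex a, (Λ k : ℝ) / Real.sqrt k *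 ((χ (k : ZMod q)).re * Real.sin (freq a (if (i : ℕ) % 2 = 1 then ((((i : ℕ) + 1) / 2 : ℕ) : ℤ) else -((((i : ℕ) / 2 : ℕ) : ℤ))) * Real.log k) + (χ (k : ZMod q)).im * Real.cos (freq a (if (i : ℕ) % 2 = 1 then ((((i : ℕ) + 1) / 2 : ℕ) : ℤ) else -((((i : ℕ) / 2 : ℕ) : ℤ))) * Real.log k))) - archExpSumSin a (if (i : ℕ) % 2 = 1 then ((((i : ℕ) + 1) / 2 : ℕ) : ℤ) else -((((i : ℕ) / 2 : ℕ) : ℤ)))) / π)) * x i) ^ 2 * ∑ j' : Fin J,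
                  ((1 / ((((j : ℕ) + 1) + ((j' : ℕ) + 1) - 1 : ℕ) * (((B₃ - 1 : ℕ) : ℝ)) ^ (((j : ℕ) + 1) + ((j' : ℕ) + 1) - 1))
                    - 1 / ((((j : ℕ) + 1) + ((j' : ℕ) + 1) - 1 : ℕ) * (B₃ : ℝ) ^ (((j : ℕ) + 1) + ((j' : ℕ) + 1) - 1))) / 2)
                  * lam j' / lam j)
        + (1 + θ⁻¹) * (((2 * B - 1 : ℕ) : ℝ) / (d₀ * ((2 * J + 1 : ℕ) * (((B₃ - 1 : ℕ) : ℝ)) ^ (2 * J + 1))))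
          * ∑ i : Fin (2 * B - 1), (4 * (π / 4 + (∑ k ∈ weilPrimeIndex a, (Λ k : ℝ) / Real.sqrt k) + a * (1 + weilArchDensity (2 * a)) / π) * (((if (i : ℕ) % 2 = 1 then ((((i : ℕ) + 1) / 2 : ℕ) : ℤ) else -((((i : ℕ) / 2 : ℕ) : ℤ)))).natAbs : ℝ) ^ J / π) ^ 2 * x i ^ 2 := by
  have hB₃ : 2 ≤ B₃ := by omega
  have hB₃1 : 1 ≤ B₃ := by omega
  -- abbreviate the row modes and the mode function
  set ι : Fin (2 * B - 1) → ℤ := fun i ↦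
    (if (i : ℕ) % 2 = 1 then ((((i : ℕ) + 1) / 2 : ℕ) : ℤ) else -((((i : ℕ) / 2 : ℕ) : ℤ))) with hι
  set F : ℤ → ℝ := fun n ↦ (Complex.digamma (1 / 4 + ((freq a n : ℝ) : ℂ) / 2 * I)).im / 2
      + (∑ k ∈ weilPrimeIndex a, (Λ k : ℝ) / Real.sqrt k *
          ((χ (k : ZMod q)).re * Real.sin (freq a n * Real.log k) + (χ (k : ZMod q)).im * Real.cos (freq a n * Real.log k)))
      - archExpSumSin a n with hF
  have hιB : ∀ i : Fin (2 * B - 1), (ι i).natAbs ≤ B - 1 := fun i ↦ by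
    simp only [hι]; exact natAbs_iota_le i
  have h := cauchy_tailJ_majorant (Bb := 2 * B - 1) (J := J) hB₃
    (fun m i ↦ (twistedGramCoeffC χ a (ι i) (m : ℤ)).re) (fun m ↦ F (m : ℤ))
    (CA := π / 4 + (∑ k ∈ weilPrimeIndex a, (Λ k : ℝ) / Real.sqrt k) + a * (1 + weilArchDensity (2 * a)) / (π * B₃))
    (fun j i ↦ (-1 : ℝ) ^ (ι i) * ((ι i : ℤ) : ℝ) ^ (j : ℕ))
    (fun j i ↦ (-1 : ℝ) ^ (ι i) * (-(((ι i : ℤ) : ℝ) ^ (j : ℕ)) * F (ι i) / π))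
    (fun i ↦ 4 * (π / 4 + (∑ k ∈ weilPrimeIndex a, (Λ k : ℝ) / Real.sqrt k) + a * (1 + weilArchDensity (2 * a)) / π)
      * ((ι i).natAbs : ℝ) ^ J / π)
    lam hlam (fun m hm ↦ by
      have h := abs_complexModeF_le_far χ ha hB₃1 (m := (m : ℤ)) (by simpa using hm)
      simpa only [hF] using h)
    (fun m hm i ↦ by
      have hm0 : (m : ℤ) ≠ 0 := by have : 1 ≤ m := le_trans hB₃1 hm; omega
      have hpm : 2 * (ι i).natAbs ≤ (m : ℤ).natAbs := by
        rw [Int.natAbs_natCast]; have := hιB i; omega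
      have h := abs_re_twistedGramCoeffC_col_sub_families_le χ ha (p := ι i) hm0 hpm J
      rw [Finset.sum_range (fun j ↦ ((-1 : ℝ) ^ (ι i) * ((ι i : ℤ) : ℝ) ^ j) / (((m : ℤ) : ℤ) : ℝ) ^ (j + 1)),
        Finset.sum_range (fun j ↦ ((-1 : ℝ) ^ (ι i) * (-(((ι i : ℤ) : ℝ) ^ j) *
          ((Complex.digamma (1 / 4 + ((freq a (ι i) : ℝ) : ℂ) / 2 * I)).im / 2
            + (∑ k ∈ weilPrimeIndex a, (Λ k : ℝ) / Real.sqrt k *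
                ((χ (k : ZMod q)).re * Real.sin (freq a (ι i) * Real.log k)
                  + (χ (k : ZMod q)).im * Real.cos (freq a (ι i) * Real.log k)))
            - archExpSumSin a (ι i)) / π)) / (((m : ℤ) : ℤ) : ℝ) ^ (j + 1))] at h
      simp only [Int.cast_natCast, zpow_natCast, Int.natAbs_natCast] at h
      simpa only [hF] using h)
    d hd₀ hd hθ hη N x
  simpa only [hι, hF] using h


/-- **Order-`J` tail majorant, far modes `−m`, `m ≥ B₃` (negative side).**  Same as the positive side with the
families multiplied by `(−1)^{j+1}` (from `1/(−m)^{j+1}`) and the mode function `F^χ_{−m}`. -/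
theorem complex_tailJ_majorant_neg (χ : DirichletCharacter ℂ q) (ha : 0 < a) {B B₃ : ℕ} (hB : 1 ≤ B)
    (hBB : 2 * B ≤ B₃) (J : ℕ) (lam : Fin J → ℝ) (hlam : ∀ j, 0 < lam j)
    (d : ℕ → ℝ) {d₀ : ℝ} (hd₀ : 0 < d₀) (hd : ∀ m, B₃ ≤ m → d₀ ≤ d m) {θ η : ℝ} (hθ : 0 < θ) (hη : 0 < η)
    (N : ℕ) (x : Fin (2 * B - 1) → ℝ) :
    ∑ m ∈ Finset.Ico B₃ N, (∑ i : Fin (2 * B - 1),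
        (twistedGramCoeffC χ a (if (i : ℕ) % 2 = 1 then ((((i : ℕ) + 1) / 2 : ℕ) : ℤ) else -((((i : ℕ) / 2 : ℕ) : ℤ))) (-(m : ℤ))).re * x i) ^ 2 / d m
      ≤ (1 + θ) * (1 + η) * ((π / 4 + (∑ k ∈ weilPrimeIndex a, (Λ k : ℝ) / Real.sqrt k) + a * (1 + weilArchDensity (2 * a)) / (π * B₃)) ^ 2 / (π ^ 2 * d₀))
          * ((∑ j : Fin J, ∑ j' : Fin J, (∑ i : Fin (2 * B - 1), ((-1 : ℝ) ^ ((j : ℕ) + 1) * ((-1 : ℝ) ^ (if (i : ℕ) % 2 = 1 then ((((i : ℕ) + 1) / 2 : ℕ) : ℤ) else -((((i : ℕ) / 2 : ℕ) : ℤ))) * (((if (i : ℕ) % 2 = 1 then ((((i : ℕ) + 1) / 2 : ℕ) : ℤ) else -((((i : ℕ) / 2 : ℕ) : ℤ))) : ℤ) : ℝ) ^ (j : ℕ))) * x i) * (∑ i : Fin (2 * B - 1), ((-1 : ℝ) ^ ((j' : ℕ) + 1) * ((-1 : ℝ) ^ (if (i : ℕ) % 2 = 1 then ((((i : ℕ)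 + 1) / 2 : ℕ) : ℤ) else -((((i : ℕ) / 2 : ℕ) : ℤ))) * (((if (i : ℕ) % 2 = 1 then ((((i : ℕ) + 1) / 2 : ℕ) : ℤ) else -((((i : ℕ) / 2 : ℕ) : ℤ))) : ℤ) : ℝ) ^ (j' : ℕ))) * x i)
                * ((1 / ((((j : ℕ) + 1) + ((j' : ℕ) + 1) - 1 : ℕ) * (((B₃ - 1 : ℕ) : ℝ)) ^ (((j : ℕ) + 1) + ((j' : ℕ) + 1) - 1))
                    + 1 / ((((j : ℕ) + 1) + ((j' : ℕ) + 1) - 1 : ℕ) * (B₃ : ℝ) ^ (((j : ℕ) + 1) + ((j' : ℕ) + 1) - 1))) / 2))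
              + ∑ j : Fin J, (∑ i : Fin (2 * B - 1), ((-1 : ℝ) ^ ((j : ℕ) + 1) * ((-1 : ℝ) ^ (if (i : ℕ) % 2 = 1 then ((((i : ℕ) + 1) / 2 : ℕ) : ℤ) else -((((i : ℕ) / 2 : ℕ) : ℤ))) * (((if (i : ℕ) % 2 = 1 then ((((i : ℕ) + 1) / 2 : ℕ) : ℤ) else -((((i : ℕ) / 2 : ℕ) : ℤ))) : ℤ) : ℝ) ^ (j : ℕ))) * x i) ^ 2 * ∑ j' : Fin J,
                  ((1 / ((((j : ℕ) + 1) + ((j' : ℕ) + 1) - 1 : ℕ) * (((B₃ - 1 : ℕ) : ℝ)) ^ (((j : ℕ) + 1) + ((j' : ℕ) + 1) - 1))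
                    - 1 / ((((j : ℕ) + 1) + ((j' : ℕ) + 1) - 1 : ℕ) * (B₃ : ℝ) ^ (((j : ℕ) + 1) + ((j' : ℕ) + 1) - 1))) / 2)
                  * lam j' / lam j)
        + (1 + θ) * (1 + η⁻¹) * (1 / d₀)
          * ((∑ j : Fin J, ∑ j' : Fin J, (∑ i : Fin (2 * B - 1), ((-1 : ℝ) ^ ((j : ℕ) + 1) * ((-1 : ℝ) ^ (if (i : ℕ) % 2 = 1 then ((((i : ℕ) + 1) / 2 : ℕ) : ℤ) else -((((i : ℕ) / 2 : ℕ) : ℤ))) * (-((((if (i : ℕ) % 2 = 1 then ((((i : ℕ) + 1) / 2 : ℕ) : ℤ) else -((((i : ℕ) / 2 : ℕ) : ℤ))) : ℤ) : ℝ) ^ (j : ℕ)) * ((Complex.digamma (1 / 4 + ((freq a (if (i : ℕ) % 2 = 1 then ((((i : ℕ) + 1) / 2 : ℕ) : ℤ) else -((((i : ℕ) / 2 : ℕ) : ℤ))) : ℝ) : ℂ) / 2 * I)).im / 2 + (∑ k ∈ weilPrimeIndex a, (Λ k : ℝ) / Real.sqrt k * ((χ (k : ZMod q)).re * Real.sin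 (freq a (if (i : ℕ) % 2 = 1 then ((((i : ℕ) + 1) / 2 : ℕ) : ℤ) else -((((i : ℕ) / 2 : ℕ) : ℤ))) * Real.log k) + (χ (k : ZMod q)).im * Real.cos (freq a (if (i : ℕ) % 2 = 1 then ((((i : ℕ) + 1) / 2 : ℕ) : ℤ) else -((((i : ℕ) / 2 : ℕ) : ℤ))) * Real.log k))) - archExpSumSin a (if (i : ℕ) % 2 = 1 then ((((i : ℕ) + 1) / 2 : ℕ) : ℤ) else -((((i : ℕ) / 2 : ℕ) : ℤ)))) / π))) * x i) * (∑ i : Fin (2 * B - 1), ((-1 : ℝ) ^ ((j' : ℕ) + 1) * ((-1 : ℝ) ^ (if (i : ℕ) % 2 = 1 then ((((i : ℕ) + 1) / 2 : ℕ) : ℤ) else -((((i : ℕ) / 2 : ℕ) : ℤ))) * (-((((if (i : ℕ) % 2 = 1 then ((((i : ℕ) + 1) / 2 : ℕ) : ℤ) else -((((i : ℕ) / 2 : ℕ) : ℤ))) : ℤ) : ℝ) ^ (j' : ℕ)) * ((Complex.digamma (1 / 4 + ((freq a (if (i : ℕ) % 2 = 1 then ((((i : ℕ) + 1) / 2 :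 ℕ) : ℤ) else -((((i : ℕ) / 2 : ℕ) : ℤ))) : ℝ) : ℂ) / 2 * I)).im / 2 + (∑ k ∈ weilPrimeIndex a, (Λ k : ℝ) / Real.sqrt k * ((χ (k : ZMod q)).re * Real.sin (freq a (if (i : ℕ) % 2 = 1 then ((((i : ℕ) + 1) / 2 : ℕ) : ℤ) else -((((i : ℕ) / 2 : ℕ) : ℤ))) * Real.log k) + (χ (k : ZMod q)).im * Real.cos (freq a (if (i : ℕ) % 2 = 1 then ((((i : ℕ) + 1) / 2 : ℕ) : ℤ) else -((((i : ℕ) / 2 : ℕ) : ℤ))) * Real.log k))) - archExpSumSin a (if (i : ℕ) % 2 = 1 then ((((i : ℕ) + 1) / 2 : ℕ) : ℤ) else -((((i : ℕ) / 2 : ℕ) : ℤ)))) / π))) * x i)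
                * ((1 / ((((j : ℕ) + 1) + ((j' : ℕ) + 1) - 1 : ℕ) * (((B₃ - 1 : ℕ) : ℝ)) ^ (((j : ℕ) + 1) + ((j' : ℕ) + 1) - 1))
                    + 1 / ((((j : ℕ) + 1) + ((j' : ℕ) + 1) - 1 : ℕ) * (B₃ : ℝ) ^ (((j : ℕ) + 1) + ((j' : ℕ) + 1) - 1))) / 2))
              + ∑ j : Fin J, (∑ i : Fin (2 * B - 1), ((-1 : ℝ) ^ ((j : ℕ) + 1) * ((-1 : ℝ) ^ (if (i : ℕ) % 2 = 1 then ((((i : ℕ) + 1) / 2 : ℕ) : ℤ) else -((((i : ℕ) / 2 : ℕ) : ℤ))) * (-((((if (i : ℕ) % 2 = 1 then ((((i : ℕ) + 1) / 2 : ℕ) : ℤ) else -((((i : ℕ) / 2 : ℕ) : ℤ))) : ℤ) : ℝ) ^ (j : ℕ)) * ((Complex.digamma (1 / 4 + ((freq a (if (i : ℕ) % 2 = 1 then ((((i : ℕ) + 1) / 2 : ℕ) : ℤ) else -((((i : ℕ) / 2 : ℕ) : ℤ))) : ℝ) : ℂ) / 2 * I)).im / 2 + (∑ k ∈ weilPrimeIndex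 a, (Λ k : ℝ) / Real.sqrt k * ((χ (k : ZMod q)).re * Real.sin (freq a (if (i : ℕ) % 2 = 1 then ((((i : ℕ) + 1) / 2 : ℕ) : ℤ) else -((((i : ℕ) / 2 : ℕ) : ℤ))) * Real.log k) + (χ (k : ZMod q)).im * Real.cos (freq a (if (i : ℕ) % 2 = 1 then ((((i : ℕ) + 1) / 2 : ℕ) : ℤ) else -((((i : ℕ) / 2 : ℕ) : ℤ))) * Real.log k))) - archExpSumSin a (if (i : ℕ) % 2 = 1 then ((((i : ℕ) + 1) / 2 : ℕ) : ℤ) else -((((i : ℕ) / 2 : ℕ) : ℤ)))) / π))) * x i) ^ 2 * ∑ j' : Fin J,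
                  ((1 / ((((j : ℕ) + 1) + ((j' : ℕ) + 1) - 1 : ℕ) * (((B₃ - 1 : ℕ) : ℝ)) ^ (((j : ℕ) + 1) + ((j' : ℕ) + 1) - 1))
                    - 1 / ((((j : ℕ) + 1) + ((j' : ℕ) + 1) - 1 : ℕ) * (B₃ : ℝ) ^ (((j : ℕ) + 1) + ((j' : ℕ) + 1) - 1))) / 2)
                  * lam j' / lam j)
        + (1 + θ⁻¹) * (((2 * B - 1 : ℕ) : ℝ) / (d₀ * ((2 * J + 1 : ℕ) * (((B₃ - 1 : ℕ) : ℝ)) ^ (2 * J + 1))))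
          * ∑ i : Fin (2 * B - 1), (4 * (π / 4 + (∑ k ∈ weilPrimeIndex a, (Λ k : ℝ) / Real.sqrt k) + a * (1 + weilArchDensity (2 * a)) / π) * (((if (i : ℕ) % 2 = 1 then ((((i : ℕ) + 1) / 2 : ℕ) : ℤ) else -((((i : ℕ) / 2 : ℕ) : ℤ)))).natAbs : ℝ) ^ J / π) ^ 2 * x i ^ 2 := by
  have hB₃ : 2 ≤ B₃ := by omega
  have hB₃1 : 1 ≤ B₃ := by omega
  set ι : Fin (2 * B - 1) → ℤ := fun i ↦
    (if (i : ℕ) % 2 = 1 then ((((i : ℕ) + 1) / 2 : ℕ) : ℤ) else -((((i : ℕ) / 2 : ℕ) : ℤ))) with hι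
  set F : ℤ → ℝ := fun n ↦ (Complex.digamma (1 / 4 + ((freq a n : ℝ) : ℂ) / 2 * I)).im / 2
      + (∑ k ∈ weilPrimeIndex a, (Λ k : ℝ) / Real.sqrt k *
          ((χ (k : ZMod q)).re * Real.sin (freq a n * Real.log k) + (χ (k : ZMod q)).im * Real.cos (freq a n * Real.log k)))
      - archExpSumSin a n with hF
  have hιB : ∀ i : Fin (2 * B - 1), (ι i).natAbs ≤ B - 1 := fun i ↦ by
    simp only [hι]; exact natAbs_iota_le i
  have h := cauchy_tailJ_majorant (Bb := 2 * B - 1) (J := J) hB₃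
    (fun m i ↦ (twistedGramCoeffC χ a (ι i) (-(m : ℤ))).re) (fun m ↦ F (-(m : ℤ)))
    (CA := π / 4 + (∑ k ∈ weilPrimeIndex a, (Λ k : ℝ) / Real.sqrt k) + a * (1 + weilArchDensity (2 * a)) / (π * B₃))
    (fun j i ↦ (-1 : ℝ) ^ ((j : ℕ) + 1) * ((-1 : ℝ) ^ (ι i) * ((ι i : ℤ) : ℝ) ^ (j : ℕ)))
    (fun j i ↦ (-1 : ℝ) ^ ((j : ℕ) + 1) * ((-1 : ℝ) ^ (ι i) * (-(((ι i : ℤ) : ℝ) ^ (j : ℕ)) * F (ι i) / π)))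
    (fun i ↦ 4 * (π / 4 + (∑ k ∈ weilPrimeIndex a, (Λ k : ℝ) / Real.sqrt k) + a * (1 + weilArchDensity (2 * a)) / π)
      * ((ι i).natAbs : ℝ) ^ J / π)
    lam hlam (fun m hm ↦ by
      have h := abs_complexModeF_le_far χ ha hB₃1 (m := -(m : ℤ)) (by simpa using hm)
      simpa only [hF] using h)
    (fun m hm i ↦ by
      have hm0 : (-(m : ℤ)) ≠ 0 := by have : 1 ≤ m := le_trans hB₃1 hm; omega
      have hpm : 2 * (ι i).natAbs ≤ (-(m : ℤ)).natAbs := by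
        rw [Int.natAbs_neg, Int.natAbs_natCast]; have := hιB i; omega
      have h := abs_re_twistedGramCoeffC_col_sub_families_le χ ha (p := ι i) hm0 hpm J
      rw [Finset.sum_range (fun j ↦ ((-1 : ℝ) ^ (ι i) * ((ι i : ℤ) : ℝ) ^ j) / (((-(m : ℤ)) : ℤ) : ℝ) ^ (j + 1)),
        Finset.sum_range (fun j ↦ ((-1 : ℝ) ^ (ι i) * (-(((ι i : ℤ) : ℝ) ^ j) *
          ((Complex.digamma (1 / 4 + ((freq a (ι i) : ℝ) : ℂ) / 2 * I)).im / 2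
            + (∑ k ∈ weilPrimeIndex a, (Λ k : ℝ) / Real.sqrt k *
                ((χ (k : ZMod q)).re * Real.sin (freq a (ι i) * Real.log k)
                  + (χ (k : ZMod q)).im * Real.cos (freq a (ι i) * Real.log k)))
            - archExpSumSin a (ι i)) / π)) / (((-(m : ℤ)) : ℤ) : ℝ) ^ (j + 1))] at h
      simp only [Int.cast_neg, Int.cast_natCast, neg_one_zpow_neg_natCast, Int.natAbs_neg, Int.natAbs_natCast,
        div_neg_pow_eq] at h
      simpa only [hF] using h)
    d hd₀ hd hθ hη N x
  simpa only [hι, hF] using h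

end Instances


end Summit.Ventures.WeilGRH

end
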